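import Summits.QuantumFields.YangMills.Theorems.BalabanUVNodesN22EdgeAtW1Reading13
import Summits.QuantumFields.YangMills.Theorems.BalabanUVNodesRateReadingOfRecord13CoPR
import Summits.QuantumFields.YangMills.Theorems.BalabanUVNodesN22EdgeAtW1Reading12

/-!
# v1.6 `CoPR` EDITION (RUN-INDEXED RESIDUAL 𝐓-WEIGHTS, FINDING №8) of 7″ — THE EDGE N18 → N22 at any `hpin`-reading ∕ the reading of record: STRIP (regime home) + ANALYTIC (canonical ∕ regime).  The `CoP ↦ CoPR` image of this seat's v1.5 module `BalabanUVNodesN22EdgeAtW1Reading13CoP` (p527072).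
#
# WHY THIS FILE EXISTS (director-ym LINE №169 H1 ∕ №173 ∕ ★ №174 PRESS WORD «v1.6 → rev 22 is authorised … pens port their OWN files by token», pub-ymgap INBOX l.19279;
# node00-def-T INTENT-25∕26T l.19481 + FILED-25 l.19522; dag-lead DEDUP-286 l.19497; plan g69 PREPRESS-22 l.19542).  FINDING №8 (def-T LOCATED-8, ref-D GATE-(g1) REAL,
# dag-n11-d (★) not provable): the v1.5 record held the residual part of print's 𝐓-weights ζ(Ω^c_{k+1}) ([Balaban1988Convergent] (1.11) p.248, (3.16)–(3.20)
# pp.268–269) in a slot `θ.Zt K` indexed by the run LENGTH `K` alone, NARROWER than print (the weights of a run depend on the run's own sequence of restrictions);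
# def-T's FILE 25 `Node00/Record13CoPR` (p529474) therefore introduced `structure Stage13RParams extends Stage13Params` with ONE new RUN-INDEXED field
# `Zr : (p : B12.RunParams) → TkResidualW Fam N (FluctV N) p.K`, the guard `Stage13RParams.ZrUnity` (print's partition of unity, replacing 12b's `ZtUnity`), the proviso
# core `Stage13RParams.Provisos₁₃CoPR` (v1.2's `Provisos₁₃Core` rows verbatim at `θ.toStage13Params` + `zrLaws ∕ zrLocal`), the datum `datumOfRecord₁₃CoPR F N θ h` and the
# record class `IsRecordOfRecord₁₃CCoPR` (+ the one-way run-blind embedding `Stage13RParams.ofRunBlind` from v1.5); RR-2 re-keyed the datum key on it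
# (`Node00/Record13DatumKeyCoPR`, p?: `IsDatumOfRecord₁₃CCoPR ∕ CCoPROn ∕ CCoPRN`, `IsRecordOfRecord₁₃CCoPROn ∕ CCoPRN`, the guard of record `unityNondeg₁₃R`); plan presses rev 22
# (⁶ = T₆(⁵): the four cruxes re-minted over `Stage13RParams`, K3⁶ `SpineGivenEndpointR13SepCoPR`).  A theorem binding `θ : Stage13Params` cannot be applied at a
# `Stage13RParams` item tuple's datum (another datum), so every storey typed `∀ (θ : Stage13Params F N) (hc : θ.Provisos₁₃Core F N), …` is re-keyed ONCE MORE; this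
# file is the (T-RATE) pen's image of its own v1.5 module under def-T's KEY-RULE-25 (= dag-lead's WORDS-142 legend), token for token:
#   binder `Stage13Params ↦ Stage13RParams` (the readings `lit ∕ ne1`, the residual maps `w1 ∕ ℓ₃ ∕ ne2`, the regimes `Rg` and the selectors `ksel` are typed over
#   `Stage13RParams`) · `θ.Provisos₁₃Core ↦ θ.Provisos₁₃CoPR` · `datumOfRecord₁₃CoP ↦ datumOfRecord₁₃CoPR` · `(Is|is)DatumOfRecord₁₃CCoP(On|N) ↦ …₁₃CCoPR(On|N)` ·
#   `(Is|is)RecordOfRecord₁₃CCoP(On|N) ↦ …₁₃CCoPR(On|N)` · guard `θ.ZtUnity ↦ θ.ZrUnity`, `Node00.unityNondeg₁₃ ↦ Node00.unityNondeg₁₃R` · THIS seat's stems `…₁₃CoP… ↦ …₁₃CoPR…`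
#   (`RateReading₁₃CoPR`, `rateCarriersOfRecord₁₃CoPR`, `RRec₁₃CoPR(On)`, `rRec₁₃CoPR…`, `readingOfRecord₁₃CoPR`, `…datumKey₁₃CoPR…`, `n22_tupleReadingOfRecordCoPR(On)…`) and
#   module names `…13CoP… ↦ …13CoPR…`;
#   SITE-RULE (KEY-RULE-25: `X F N θ ↦ X F N θ.toStage13Params` for every θ-level X NOT re-issued — the rate objects read NO 𝐓-weight slot): the ‴ bundle
#   `u3OfRecord₁₃ θ u k ↦ u3OfRecord₁₃ θ.toStage13Params u k` (its faces `u3OfRecord₁₃_W ∕ _γ ∕ _Λ ∕ _C ∕ _EA ∕ _EB ∕ _eq_u3OfRecord₁₂ ∕ _eq_toStage11 ∕ fadingMemory_u3OfRecord₁₃ ∕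
#   n22At_u3OfRecord₁₃_iff ∕ u3OfRecord₁₃_objects` and every θ-form closer `n22At_u3OfRecord₁₃_…` of the ‴ modules are applied AT `θ.toStage13Params`, imported BY NAME
#   from the ‴ original this module imports); the parent views `θ.toStage12Params ∕ θ.γ ∕ θ.L`, `θ.Admissible F N`, `θ.SlotsNondegenerate₁₃ F N` resolve through
#   `extends` (unchanged text).
# Statements = the v1.5 statements under the map, proofs = the v1.5 proofs verbatim (kernel re-derivations BY NAME); the ‴ ∕ ⁗ ∕ Co ∕ CoP editions of this module stay
# in the tree as the aside items' context (nothing landed is edited or re-declared).  bg-BLIND and 𝐓-WEIGHT-BLIND: like its predecessors, nothing here reads any FIELD of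
# the proviso or the slot `θ.Zr` — they enter only as the binder TYPES of the readings and through RR-2's key — which is why the port is a token map.
#
# ITEM IDS: crux names ∕ item ids quoted in the ‴ header of record below (K0‴–K3‴ = stmt-QuantumFields-19909…19912, `Record13Inhabited`, `SpineGivenEndpointR13`; in
# places the ⁵ ids) are those of EARLIER revisions, asides since rev 22∕23; this file is filed `--supports stmt-QuantumFields-20509` (K3⁶ `SpineGivenEndpointR13SepCoPR`, the K3 item of
# record per dag-lead's KEY MAP WORDS-142, pub-ymgap INBOX l.19649) as a HELPER — count-neutral, no stub closed, N22 NOT discharged, no inhabitant of any key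
# claimed (K0 OPEN at every edition), nothing of Bałaban asserted; one finite 𝕋⁴ programme at fixed ε — NOT continuum ∕ OS ∕ mass-gap ∕ Clay.
#
# ‴ HEADER OF RECORD FOLLOWS (token-mapped; its decl lists are this file's, the θ-only names above excepted):
#
# BalabanUVNodes ∕ node N22 ⟸ node N18 AT A W1-PINNED READING OF THE STAGE-13 HOMES `RRec₁₃CoPR 𝔯` ∕ `RRec₁₃CoPROn 𝔯 Rg` and AT THE STAGE-13 READING OF RECORD — the edge
# N18 → N22 BY NAME at `Record13`, in the STRIP currency (dag-n22-c's θ-form `n22At_u3OfRecord₁₂_w1Reading_of_n18Below_stripBound`) and in the ANALYTIC sup-letter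
# currency (A) (the lineage's θ-form `n22At_u3OfRecord₁₂_w1_of_n18Below_analytic`), both read at Stage 13 through layer B's `rfl` bridge `u3OfRecord₁₃_eq_u3OfRecord₁₂`

Track A of `YM-PLAN.md` (cell `pub-ymgap`, HUMAN RULING D-0062), R134 seat `pub-ymgap-dag-n22-e` (s2 «`FadingMemory` by name from a modulus + knit at the record»), gen 5,
module 7″ = the Stage-13 edition of the lineage's module 7 `…N22EdgeAtW1Reading12.lean` (p478043), GENERALISED (like 9″c) from the one named reading
`ofAssignment (W1.assignment₁₂ 𝔇) ne1` to EVERY Stage-13 reading with the W1 pin `hpin : ∀ F θ hP g₀ os, (𝔯.lit F θ hP g₀ os).u3 = (w1 F θ).u3Objects θ.γ`, and instantiated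
at the reading of record `readingOfRecord₁₃CoPR w1 ℓ₃ ne2 ne1` (module 6″, `hpin := rfl`).  Director-ym LINE №125 «RECORD 13» ∕ №133 ∕ №135 (route rev 17 READY, K3‴
`SpineGivenEndpointR13` = stmt-QuantumFields-19912); dag-lead WORDS-133 ∕ 134 ∕ 135.  THEOREMS ONLY; every proof is one application BY NAME of the Stage-12 θ-forms (dag-n22-c
`…N22W1StripN18Edge` p476424 §1–§2; this lineage's module 7 §2) at the parent tuple `θ.toStage12Params` — the Stage-13 bundle IS the Stage-12 bundle of the parent tuple
(`u3OfRecord₁₃_eq_u3OfRecord₁₂`, `rfl`) — composed with the Stage-13 homes' θ-forms (`s_N18 ∕ s_N22_rRec₁₃CoPR(On)_iff`, 9″c's `s_N22_rRec₁₃CoPR_w1_iff`).  Restate-immune (no Theses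
import); COUNT-NEUTRAL; `--supports` K3‴ as a helper.

WHAT IS KERNEL-CHECKED ([folklore]; 0 `def`, 0 `sorry`).
* §1 `s_N22_rRec₁₃CoPROn_w1_of_s_N18_stripBound` — REGIME ∕ TUPLE HOME × STRIP: `S_N18 (RRec₁₃CoPROn 𝔯 Rg)` + per admissible tuple in `Rg` dag-n22-c's coherence ∕ junk binder `hcoh`
  for `w1 F θ`, the inputs' numerals and STRIP-(1.18) per run length ⟹ `S_N22 (RRec₁₃CoPROn 𝔯 Rg)`.
* §2 `n22At_u3OfRecord₁₃_w1_of_n18Below_analytic` — θ-form at ONE Stage-13 tuple, analytic currency: N18 below `k` + (C1)(C2)(J) + (A) at `k` + numerals ⟹ `N22At` at `k`.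
* §3 `s_N22_rRec₁₃CoPR_w1_of_s_N18_analytic` (canonical home × (A)) · `s_N22_rRec₁₃CoPROn_w1_of_s_N18_analytic` (regime home × (A)).
* §4 AT THE READING OF RECORD (6″): `s_N22_readingOfRecord₁₃CoPR_of_s_N18_analytic` · `s_N22_readingOfRecord₁₃CoPROn_of_s_N18_analytic` · `s_N22_readingOfRecord₁₃CoPROn_of_s_N18_stripBound`.

HONEST FRAMING.  The edge TRANSFERS node N18's stub (a hypothesis at the same reading; dag-n18-d's lane) and dag-n22-c's displayed regularity inputs (STRIP-(1.18) per run length,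
or the analytic sup letter (A); coherence (C1)(C2), junk-freeness (J); numerals) into node N22's stub; none of these has a producer at a reading of record today; W1's towers are
residual DATA; nothing of Bałaban's is asserted or instantiated — NE5 ∕ NE9 NOT PRINTED for d = 4 and NOT PROVED; no inhabitant of `IsDatumOfRecord₁₃CCoPR` claimed (K0‴
`Record13Inhabited`, stmt-QuantumFields-19909, OPEN); N22 NOT discharged; counts UNMOVED (typed 28∕28 · discharged 5∕27, A 5∕28); one finite four-torus programme at fixed `ε` —
NOT ℝ⁴, NOT infinite volume, NOT OS, NOT a mass gap, NOT Clay.  No decl below carries a cite tag.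
-/

noncomputable section

namespace YMDAG.N22

open Set Metric
open scoped BigOperators
open Literature.MathematicalPhysics.QuantumFieldTheory.Balaban1983to89
open Literature.MathematicalPhysics.QuantumFieldTheory.Balaban1983to89.T4Continuum
open Literature.MathematicalPhysics.QuantumFieldTheory.Balaban1983to89.T4OutputRate
open Literature.MathematicalPhysics.QuantumFieldTheory.Balaban1983to89.TreeLengthTorus (torusTreeLen)
open Literature.MathematicalPhysics.QuantumFieldTheory.Balaban1983to89.Node00 (Stage13RParams IsDatumOfRecord₁₃CCoPR NE2Objects₁₁ NE3Letters₁₁ MatA)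
open Literature.MathematicalPhysics.QuantumFieldTheory.Balaban1983to89.Node00.Sect2 (domSys CPair)
open Literature.MathematicalPhysics.QuantumFieldTheory.Balaban1983to89.Node00.W1 (ReadingData termC)
open YMDAG.UVSplit
open YMDAG.N22.W1 (oscFading_w1Reading_of_n18At_below n22At_u3OfRecord₁₂_w1Reading_of_n18Below_stripBound)

variable {N : ℕ} [NeZero N]

/-! ## §1 The edge at the regime ∕ tuple home `RRec₁₃CoPROn 𝔯 Rg`, strip currency, for a W1-pinned reading -/

section RegimeStrip

variable (𝔯 : RateReading₁₃CoPR N) (w1 : (F : T4Family) → (θ : Stage13RParams F N) → ReadingData F (MatA N) θ.τ9.M) (Rg : (F : T4Family) → Stage13RParams F N → Prop)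

open Classical in
/-- **THE EDGE N18 → N22 AT A W1-PINNED STAGE-13 READING, REGIME ∕ TUPLE HOME, STRIP CURRENCY.**  For ANY reading `𝔯` with `(𝔯.lit F θ hP g₀ os).u3 = (w1 F θ).u3Objects θ.γ`
and ANY regime `Rg`: `S_N18 (RRec₁₃CoPROn 𝔯 Rg)` together with, per admissible Stage-13 tuple with provisos IN `Rg`, dag-n22-c's coherence ∕ junk binder `hcoh` for `w1 F θ`, the
inputs' numerals and STRIP-(1.18) per run length (their `hstrip` verbatim) ⟹ `S_N22 (RRec₁₃CoPROn 𝔯 Rg)` — their θ-form at the parent tuple `θ.toStage12Params`, read through 5″'s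
guarded θ-forms.  Every hypothesis is asked ONLY in the regime. [folklore] -/
theorem s_N22_rRec₁₃CoPROn_w1_of_s_N18_stripBound
    (hpin : ∀ (F : T4Family) (θ : Stage13RParams F N) (hP : θ.Provisos₁₃CoPR F N) (g₀ : ℕ → ℝ) (os : List (ULoop F)), (𝔯.lit F θ hP g₀ os).u3 = (w1 F θ).u3Objects θ.γ)
    (h18 : S_N18 (RRec₁₃CoPROn 𝔯 Rg))
    (hcoh : ∀ (F : T4Family) (θ : Stage13RParams F N), θ.Provisos₁₃CoPR F N → Rg F θ → θ.Admissible F N →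
      (∀ (k : ℕ) (X₁ : Node00.W1.Dom (F.P k) θ.τ9.M), (((w1 F θ).pairing k).pair X₁).1 = X₁.1 + 1) ∧
      (∀ (k : ℕ) (X₁ : Node00.W1.Dom (F.P k) θ.τ9.M),
        (domSys (F.P (k + 1)) θ.τ9.M (((w1 F θ).pairing k).pair X₁).1).dj (((w1 F θ).pairing k).pair X₁).2 = (domSys (F.P k) θ.τ9.M X₁.1).dj X₁.2) ∧
      (∀ (k : ℕ) (X : Node00.W1.Dom (F.P (k + 1)) θ.τ9.M), 1 ≤ X.1 → ∃ X₁ : Node00.W1.Dom (F.P k) θ.τ9.M, ((w1 F θ).pairing k).pair X₁ = X) ∧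
      (∀ (k : ℕ) (U : ((w1 F θ).pairing (k + 1)).BgA), ∃ U₁ : ((w1 F θ).pairing k).BgB, ((w1 F θ).pairing k).embB U₁ = ((w1 F θ).pairing (k + 1)).embA U) ∧
      (∀ (k : ℕ) (g : ℕ → ℝ) (U : ((w1 F θ).pairing k).BgA) (X : Node00.W1.Dom (F.P k) θ.τ9.M), k < X.1 → ((w1 F θ).pairing k).EA ((w1 F θ).S k) g U X = 0))
    (hnum : ∀ (F : T4Family) (θ : Stage13RParams F N), θ.Provisos₁₃CoPR F N → Rg F θ → θ.Admissible F N →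
      0 < (w1 F θ).li.C₀ ∧ 0 < (w1 F θ).li.θ₅ ∧ (w1 F θ).li.θ₅ < 1 ∧ 0 ≤ (w1 F θ).li.C₅ ∧
        2 * (w1 F θ).li.C₅ / (1 - (w1 F θ).li.θ₅) ≤ (w1 F θ).li.C₀ ∧ 0 < (w1 F θ).li.A ∧ (w1 F θ).li.θ₅ ≤ (w1 F θ).li.μ ∧
        (w1 F θ).li.C₀ ≤ 2 * (w1 F θ).li.A ∧ 0 < (w1 F θ).li.r ∧ 0 < (w1 F θ).li.s ∧ (w1 F θ).li.s < 1 ∧ 1 ≤ (w1 F θ).li.μ)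
    (hstrip : ∀ (F : T4Family) (θ : Stage13RParams F N), θ.Provisos₁₃CoPR F N → Rg F θ → θ.Admissible F N → ∀ (k : ℕ),
      ∃ sp : (j : ℕ) → (domSys (F.P k) θ.τ9.M j).Dom → Set (CPair (F.P k) (MatA N)),
        (∀ (j : ℕ) (U : ((w1 F θ).pairing k).BgA) (Y : (domSys (F.P k) θ.τ9.M j).Dom), ((w1 F θ).pairing k).embA U ∈ sp j Y) ∧
        (∀ (j : ℕ) (g : ℕ → ℝ), g ∈ Window θ.γ → ∀ (i : ℕ) (Y : (domSys (F.P k) θ.τ9.M j).Dom) (ψ : CPair (F.P k) (MatA N)), ψ ∈ sp j Y →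
          ∃ (Ec : ℂ → ℂ) (O : Set ℂ), IsOpen O ∧ (∀ t ∈ Ioc (0 : ℝ) θ.γ, closedBall (t : ℂ) (w1 F θ).li.r ⊆ O) ∧ DifferentiableOn ℂ Ec O ∧
            (∀ z ∈ O, ‖Ec z‖ ≤ (w1 F θ).li.A * Real.exp (-((w1 F θ).li.κ * torusTreeLen Y.1))) ∧
            (∀ t ∈ Ioc (0 : ℝ) θ.γ, Ec t = termC ((w1 F θ).S k) j Y (Function.update g i t) ψ))) :
    S_N22 (RRec₁₃CoPROn 𝔯 Rg) := by
  rw [s_N22_rRec₁₃CoPROn_iff]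
  rw [s_N18_rRec₁₃CoPROn_iff] at h18
  intro F θ hP hRg hθ g₀ os k
  obtain ⟨hfst, hdj, hsurj, hbg, hjunk⟩ := hcoh F θ hP hRg hθ
  obtain ⟨hC₀, hθ5, hθ1, hC5, hC₀', hA, hθμ, hCM, hr, hs0, hs1, hμ1⟩ := hnum F θ hP hRg hθ
  obtain ⟨sp, hsp, hall⟩ := hstrip F θ hP hRg hθ k
  have h18' : ∀ k' : ℕ, k' < k → N18At (u3OfRecord₁₂ θ.toStage12Params ((w1 F θ).u3Objects θ.γ) k') := fun k' _ => by
    rw [← u3OfRecord₁₃_eq_u3OfRecord₁₂, ← hpin F θ hP g₀ os]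
    exact h18 F θ hP hRg hθ g₀ os k'
  rw [hpin F θ hP g₀ os, u3OfRecord₁₃_eq_u3OfRecord₁₂]
  exact n22At_u3OfRecord₁₂_w1Reading_of_n18Below_stripBound θ.toStage12Params (w1 F θ) k sp hsp hall hfst hdj hsurj hbg hjunk h18' hC5 hθ1 hC₀' hC₀ hθ5 hA hμ1
    hθμ hCM hr hθ.toStage9.gamma_pos hs0 hs1

end RegimeStrip

/-! ## §3 The edge at the Stage-13 homes, analytic currency, for a W1-pinned reading -/

section StubAnalytic

variable (𝔯 : RateReading₁₃CoPR N) (w1 : (F : T4Family) → (θ : Stage13RParams F N) → ReadingData F (MatA N) θ.τ9.M)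

/-- **THE EDGE N18 → N22 AT A W1-PINNED STAGE-13 READING, CANONICAL HOME, ANALYTIC CURRENCY.**  `S_N18 (RRec₁₃CoPR 𝔯)` and — per admissible Stage-13 tuple with provisos —
dag-n22-c's `hcoh` for `w1 F θ`, the analytic letter (A) at every run length (9″c's `hA` verbatim) and the numerals ⟹ `S_N22 (RRec₁₃CoPR 𝔯)`: at each datum key all run lengths are
bundles of record at the canonical parameter (layer B's `s_N18_rRec₁₃CoPR_iff` ∕ 9″c's `s_N22_rRec₁₃CoPR_w1_iff`), so §2 applies level by level.  This is 9″c's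
`s_N22_rRec₁₃CoPR_w1_of_oscAnalytic` with its (O) hypothesis REPLACED by `S_N18` + `hcoh`. [folklore] -/
theorem s_N22_rRec₁₃CoPR_w1_of_s_N18_analytic
    (hpin : ∀ (F : T4Family) (θ : Stage13RParams F N) (hP : θ.Provisos₁₃CoPR F N) (g₀ : ℕ → ℝ) (os : List (ULoop F)), (𝔯.lit F θ hP g₀ os).u3 = (w1 F θ).u3Objects θ.γ)
    (h18 : S_N18 (RRec₁₃CoPR 𝔯))
    (hcoh : ∀ (F : T4Family) (θ : Stage13RParams F N), θ.Provisos₁₃CoPR F N → θ.Admissible F N →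
      (∀ (k : ℕ) (X₁ : Node00.W1.Dom (F.P k) θ.τ9.M), (((w1 F θ).pairing k).pair X₁).1 = X₁.1 + 1) ∧
      (∀ (k : ℕ) (X₁ : Node00.W1.Dom (F.P k) θ.τ9.M),
        (domSys (F.P (k + 1)) θ.τ9.M (((w1 F θ).pairing k).pair X₁).1).dj (((w1 F θ).pairing k).pair X₁).2 = (domSys (F.P k) θ.τ9.M X₁.1).dj X₁.2) ∧
      (∀ (k : ℕ) (X : Node00.W1.Dom (F.P (k + 1)) θ.τ9.M), 1 ≤ X.1 → ∃ X₁ : Node00.W1.Dom (F.P k) θ.τ9.M, ((w1 F θ).pairing k).pair X₁ = X) ∧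
      (∀ (k : ℕ) (U : ((w1 F θ).pairing (k + 1)).BgA), ∃ U₁ : ((w1 F θ).pairing k).BgB, ((w1 F θ).pairing k).embB U₁ = ((w1 F θ).pairing (k + 1)).embA U) ∧
      (∀ (k : ℕ) (g : ℕ → ℝ) (U : ((w1 F θ).pairing k).BgA) (X : Node00.W1.Dom (F.P k) θ.τ9.M), k < X.1 → ((w1 F θ).pairing k).EA ((w1 F θ).S k) g U X = 0))
    (hA : ∀ (F : T4Family) (θ : Stage13RParams F N), θ.Provisos₁₃CoPR F N → θ.Admissible F N → ∀ (k : ℕ),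
      ∀ g ∈ Window θ.γ, ∀ (U : (((w1 F θ).u3Objects θ.γ).levelCarriers k).BgA) (X : (((w1 F θ).u3Objects θ.γ).levelCarriers k).Dom) (i : ℕ),
        i < (((w1 F θ).u3Objects θ.γ).levelCarriers k).scale X → ∃ (Fz : ℂ → ℂ) (Dset : Set ℂ), DifferentiableOn ℂ Fz Dset ∧
          (∀ z ∈ Dset, ‖Fz z‖ ≤ (w1 F θ).li.A * (w1 F θ).li.μ ^ ((((w1 F θ).u3Objects θ.γ).levelCarriers k).scale X - 1 - i) *
            Real.exp (-(((w1 F θ).u3Objects θ.γ).κ * (((w1 F θ).u3Objects θ.γ).levelCarriers k).d X))) ∧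
          (∀ t ∈ Ioc (0 : ℝ) θ.γ, closedBall (t : ℂ) (w1 F θ).li.r ⊆ Dset) ∧
          (∀ t ∈ Ioc (0 : ℝ) θ.γ, Fz t = (((w1 F θ).u3Objects θ.γ).EA k (Function.update g i t) U X : ℂ)))
    (hnum : ∀ (F : T4Family) (θ : Stage13RParams F N), θ.Provisos₁₃CoPR F N → θ.Admissible F N →
      0 < (w1 F θ).li.C₀ ∧ 0 < (w1 F θ).li.θ₅ ∧ (w1 F θ).li.θ₅ < 1 ∧ 0 ≤ (w1 F θ).li.C₅ ∧
        2 * (w1 F θ).li.C₅ / (1 - (w1 F θ).li.θ₅) ≤ (w1 F θ).li.C₀ ∧ 0 < (w1 F θ).li.A ∧ (w1 F θ).li.θ₅ ≤ (w1 F θ).li.μ ∧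
        (w1 F θ).li.C₀ ≤ 2 * (w1 F θ).li.A ∧ 0 < (w1 F θ).li.r ∧ 0 < (w1 F θ).li.s ∧ (w1 F θ).li.s < 1) :
    S_N22 (RRec₁₃CoPR 𝔯) := by
  rw [s_N22_rRec₁₃CoPR_w1_iff 𝔯 w1 hpin]
  rw [s_N18_rRec₁₃CoPR_iff] at h18
  intro F D h k
  obtain ⟨hfst, hdj, hsurj, hbg, hjunk⟩ := hcoh F h.params h.provisos h.admissible
  refine n22At_u3OfRecord₁₃_w1_of_n18Below_analytic h.params.toStage13Params (w1 F h.params) k (fun k' _ => ?_) hfst hdj hsurj hbg hjunk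
    (hA F h.params h.provisos h.admissible k) (hnum F h.params h.provisos h.admissible) h.gamma_pos
  rw [← hpin F h.params h.provisos (fun _ => 0) []]
  exact h18 F D h (fun _ => 0) [] k'

/-- **THE SAME AT THE REGIME ∕ TUPLE HOME** `RRec₁₃CoPROn 𝔯 Rg` (any regime `Rg`; 5″'s guarded θ-forms; the hypotheses asked only of the admissible tuples with provisos in the
regime). [folklore] -/
theorem s_N22_rRec₁₃CoPROn_w1_of_s_N18_analytic (Rg : (F : T4Family) → Stage13RParams F N → Prop)
    (hpin : ∀ (F : T4Family) (θ : Stage13RParams F N) (hP : θ.Provisos₁₃CoPR F N) (g₀ : ℕ → ℝ) (os : List (ULoop F)), (𝔯.lit F θ hP g₀ os).u3 = (w1 F θ).u3Objects θ.γ)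
    (h18 : S_N18 (RRec₁₃CoPROn 𝔯 Rg))
    (hcoh : ∀ (F : T4Family) (θ : Stage13RParams F N), θ.Provisos₁₃CoPR F N → Rg F θ → θ.Admissible F N →
      (∀ (k : ℕ) (X₁ : Node00.W1.Dom (F.P k) θ.τ9.M), (((w1 F θ).pairing k).pair X₁).1 = X₁.1 + 1) ∧
      (∀ (k : ℕ) (X₁ : Node00.W1.Dom (F.P k) θ.τ9.M),
        (domSys (F.P (k + 1)) θ.τ9.M (((w1 F θ).pairing k).pair X₁).1).dj (((w1 F θ).pairing k).pair X₁).2 = (domSys (F.P k) θ.τ9.M X₁.1).dj X₁.2) ∧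
      (∀ (k : ℕ) (X : Node00.W1.Dom (F.P (k + 1)) θ.τ9.M), 1 ≤ X.1 → ∃ X₁ : Node00.W1.Dom (F.P k) θ.τ9.M, ((w1 F θ).pairing k).pair X₁ = X) ∧
      (∀ (k : ℕ) (U : ((w1 F θ).pairing (k + 1)).BgA), ∃ U₁ : ((w1 F θ).pairing k).BgB, ((w1 F θ).pairing k).embB U₁ = ((w1 F θ).pairing (k + 1)).embA U) ∧
      (∀ (k : ℕ) (g : ℕ → ℝ) (U : ((w1 F θ).pairing k).BgA) (X : Node00.W1.Dom (F.P k) θ.τ9.M), k < X.1 → ((w1 F θ).pairing k).EA ((w1 F θ).S k) g U X = 0))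
    (hA : ∀ (F : T4Family) (θ : Stage13RParams F N), θ.Provisos₁₃CoPR F N → Rg F θ → θ.Admissible F N → ∀ (k : ℕ),
      ∀ g ∈ Window θ.γ, ∀ (U : (((w1 F θ).u3Objects θ.γ).levelCarriers k).BgA) (X : (((w1 F θ).u3Objects θ.γ).levelCarriers k).Dom) (i : ℕ),
        i < (((w1 F θ).u3Objects θ.γ).levelCarriers k).scale X → ∃ (Fz : ℂ → ℂ) (Dset : Set ℂ), DifferentiableOn ℂ Fz Dset ∧
          (∀ z ∈ Dset, ‖Fz z‖ ≤ (w1 F θ).li.A * (w1 F θ).li.μ ^ ((((w1 F θ).u3Objects θ.γ).levelCarriers k).scale X - 1 - i) *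
            Real.exp (-(((w1 F θ).u3Objects θ.γ).κ * (((w1 F θ).u3Objects θ.γ).levelCarriers k).d X))) ∧
          (∀ t ∈ Ioc (0 : ℝ) θ.γ, closedBall (t : ℂ) (w1 F θ).li.r ⊆ Dset) ∧
          (∀ t ∈ Ioc (0 : ℝ) θ.γ, Fz t = (((w1 F θ).u3Objects θ.γ).EA k (Function.update g i t) U X : ℂ)))
    (hnum : ∀ (F : T4Family) (θ : Stage13RParams F N), θ.Provisos₁₃CoPR F N → Rg F θ → θ.Admissible F N →
      0 < (w1 F θ).li.C₀ ∧ 0 < (w1 F θ).li.θ₅ ∧ (w1 F θ).li.θ₅ < 1 ∧ 0 ≤ (w1 F θ).li.C₅ ∧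
        2 * (w1 F θ).li.C₅ / (1 - (w1 F θ).li.θ₅) ≤ (w1 F θ).li.C₀ ∧ 0 < (w1 F θ).li.A ∧ (w1 F θ).li.θ₅ ≤ (w1 F θ).li.μ ∧
        (w1 F θ).li.C₀ ≤ 2 * (w1 F θ).li.A ∧ 0 < (w1 F θ).li.r ∧ 0 < (w1 F θ).li.s ∧ (w1 F θ).li.s < 1) :
    S_N22 (RRec₁₃CoPROn 𝔯 Rg) := by
  rw [s_N22_rRec₁₃CoPROn_iff]
  rw [s_N18_rRec₁₃CoPROn_iff] at h18
  intro F θ hP hRg hθ g₀ os k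
  obtain ⟨hfst, hdj, hsurj, hbg, hjunk⟩ := hcoh F θ hP hRg hθ
  rw [hpin F θ hP g₀ os]
  refine n22At_u3OfRecord₁₃_w1_of_n18Below_analytic θ.toStage13Params (w1 F θ) k (fun k' _ => ?_) hfst hdj hsurj hbg hjunk (hA F θ hP hRg hθ k) (hnum F θ hP hRg hθ)
    hθ.toStage9.gamma_pos
  rw [← hpin F θ hP g₀ os]
  exact h18 F θ hP hRg hθ g₀ os k'

end StubAnalytic

/-! ## §4 The edge at the Stage-13 reading of record (module 6″), both homes, both currencies -/

section ReadingOfRecord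

variable (w1 : (F : T4Family) → (θ : Stage13RParams F N) → ReadingData F (MatA N) θ.τ9.M) (ℓ₃ : T4Family → NE3Letters₁₁)
  (ne2 : (F : T4Family) → Stage13RParams F N → (ℕ → ℝ) → List (ULoop F) → ℕ → NE2Objects₁₁)
  (ne1 : (F : T4Family) → Stage13RParams F N → (ℕ → ℝ) → List (ULoop F) → NE1pCarriers)

/-- **THE EDGE AT THE READING OF RECORD, CANONICAL HOME, ANALYTIC CURRENCY** (§3 at `readingOfRecord₁₃CoPR w1 ℓ₃ ne2 ne1`, `hpin := rfl`; `ℓ₃ ∕ ne2 ∕ ne1` idle). [folklore] -/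
theorem s_N22_readingOfRecord₁₃CoPR_of_s_N18_analytic
    (h18 : S_N18 (RRec₁₃CoPR (readingOfRecord₁₃CoPR w1 ℓ₃ ne2 ne1)))
    (hcoh : ∀ (F : T4Family) (θ : Stage13RParams F N), θ.Provisos₁₃CoPR F N → θ.Admissible F N →
      (∀ (k : ℕ) (X₁ : Node00.W1.Dom (F.P k) θ.τ9.M), (((w1 F θ).pairing k).pair X₁).1 = X₁.1 + 1) ∧
      (∀ (k : ℕ) (X₁ : Node00.W1.Dom (F.P k) θ.τ9.M),
        (domSys (F.P (k + 1)) θ.τ9.M (((w1 F θ).pairing k).pair X₁).1).dj (((w1 F θ).pairing k).pair X₁).2 = (domSys (F.P k) θ.τ9.M X₁.1).dj X₁.2) ∧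
      (∀ (k : ℕ) (X : Node00.W1.Dom (F.P (k + 1)) θ.τ9.M), 1 ≤ X.1 → ∃ X₁ : Node00.W1.Dom (F.P k) θ.τ9.M, ((w1 F θ).pairing k).pair X₁ = X) ∧
      (∀ (k : ℕ) (U : ((w1 F θ).pairing (k + 1)).BgA), ∃ U₁ : ((w1 F θ).pairing k).BgB, ((w1 F θ).pairing k).embB U₁ = ((w1 F θ).pairing (k + 1)).embA U) ∧
      (∀ (k : ℕ) (g : ℕ → ℝ) (U : ((w1 F θ).pairing k).BgA) (X : Node00.W1.Dom (F.P k) θ.τ9.M), k < X.1 → ((w1 F θ).pairing k).EA ((w1 F θ).S k) g U X = 0))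
    (hA : ∀ (F : T4Family) (θ : Stage13RParams F N), θ.Provisos₁₃CoPR F N → θ.Admissible F N → ∀ (k : ℕ),
      ∀ g ∈ Window θ.γ, ∀ (U : (((w1 F θ).u3Objects θ.γ).levelCarriers k).BgA) (X : (((w1 F θ).u3Objects θ.γ).levelCarriers k).Dom) (i : ℕ),
        i < (((w1 F θ).u3Objects θ.γ).levelCarriers k).scale X → ∃ (Fz : ℂ → ℂ) (Dset : Set ℂ), DifferentiableOn ℂ Fz Dset ∧
          (∀ z ∈ Dset, ‖Fz z‖ ≤ (w1 F θ).li.A * (w1 F θ).li.μ ^ ((((w1 F θ).u3Objects θ.γ).levelCarriers k).scale X - 1 - i) *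
            Real.exp (-(((w1 F θ).u3Objects θ.γ).κ * (((w1 F θ).u3Objects θ.γ).levelCarriers k).d X))) ∧
          (∀ t ∈ Ioc (0 : ℝ) θ.γ, closedBall (t : ℂ) (w1 F θ).li.r ⊆ Dset) ∧
          (∀ t ∈ Ioc (0 : ℝ) θ.γ, Fz t = (((w1 F θ).u3Objects θ.γ).EA k (Function.update g i t) U X : ℂ)))
    (hnum : ∀ (F : T4Family) (θ : Stage13RParams F N), θ.Provisos₁₃CoPR F N → θ.Admissible F N →
      0 < (w1 F θ).li.C₀ ∧ 0 < (w1 F θ).li.θ₅ ∧ (w1 F θ).li.θ₅ < 1 ∧ 0 ≤ (w1 F θ).li.C₅ ∧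
        2 * (w1 F θ).li.C₅ / (1 - (w1 F θ).li.θ₅) ≤ (w1 F θ).li.C₀ ∧ 0 < (w1 F θ).li.A ∧ (w1 F θ).li.θ₅ ≤ (w1 F θ).li.μ ∧
        (w1 F θ).li.C₀ ≤ 2 * (w1 F θ).li.A ∧ 0 < (w1 F θ).li.r ∧ 0 < (w1 F θ).li.s ∧ (w1 F θ).li.s < 1) :
    S_N22 (RRec₁₃CoPR (readingOfRecord₁₃CoPR w1 ℓ₃ ne2 ne1)) :=
  s_N22_rRec₁₃CoPR_w1_of_s_N18_analytic _ w1 (fun _ _ _ _ _ => rfl) h18 hcoh hA hnum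

/-- **THE EDGE AT THE READING OF RECORD, REGIME HOME, ANALYTIC CURRENCY** (any regime `Rg`; `Node00.unityNondeg₁₃R N` is rev 16's ∕ rev 22's binder prefix). [folklore] -/
theorem s_N22_readingOfRecord₁₃CoPROn_of_s_N18_analytic (Rg : (F : T4Family) → Stage13RParams F N → Prop)
    (h18 : S_N18 (RRec₁₃CoPROn (readingOfRecord₁₃CoPR w1 ℓ₃ ne2 ne1) Rg))
    (hcoh : ∀ (F : T4Family) (θ : Stage13RParams F N), θ.Provisos₁₃CoPR F N → Rg F θ → θ.Admissible F N →
      (∀ (k : ℕ) (X₁ : Node00.W1.Dom (F.P k) θ.τ9.M), (((w1 F θ).pairing k).pair X₁).1 = X₁.1 + 1) ∧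
      (∀ (k : ℕ) (X₁ : Node00.W1.Dom (F.P k) θ.τ9.M),
        (domSys (F.P (k + 1)) θ.τ9.M (((w1 F θ).pairing k).pair X₁).1).dj (((w1 F θ).pairing k).pair X₁).2 = (domSys (F.P k) θ.τ9.M X₁.1).dj X₁.2) ∧
      (∀ (k : ℕ) (X : Node00.W1.Dom (F.P (k + 1)) θ.τ9.M), 1 ≤ X.1 → ∃ X₁ : Node00.W1.Dom (F.P k) θ.τ9.M, ((w1 F θ).pairing k).pair X₁ = X) ∧
      (∀ (k : ℕ) (U : ((w1 F θ).pairing (k + 1)).BgA), ∃ U₁ : ((w1 F θ).pairing k).BgB, ((w1 F θ).pairing k).embB U₁ = ((w1 F θ).pairing (k + 1)).embA U) ∧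
      (∀ (k : ℕ) (g : ℕ → ℝ) (U : ((w1 F θ).pairing k).BgA) (X : Node00.W1.Dom (F.P k) θ.τ9.M), k < X.1 → ((w1 F θ).pairing k).EA ((w1 F θ).S k) g U X = 0))
    (hA : ∀ (F : T4Family) (θ : Stage13RParams F N), θ.Provisos₁₃CoPR F N → Rg F θ → θ.Admissible F N → ∀ (k : ℕ),
      ∀ g ∈ Window θ.γ, ∀ (U : (((w1 F θ).u3Objects θ.γ).levelCarriers k).BgA) (X : (((w1 F θ).u3Objects θ.γ).levelCarriers k).Dom) (i : ℕ),
        i < (((w1 F θ).u3Objects θ.γ).levelCarriers k).scale X → ∃ (Fz : ℂ → ℂ) (Dset : Set ℂ), DifferentiableOn ℂ Fz Dset ∧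
          (∀ z ∈ Dset, ‖Fz z‖ ≤ (w1 F θ).li.A * (w1 F θ).li.μ ^ ((((w1 F θ).u3Objects θ.γ).levelCarriers k).scale X - 1 - i) *
            Real.exp (-(((w1 F θ).u3Objects θ.γ).κ * (((w1 F θ).u3Objects θ.γ).levelCarriers k).d X))) ∧
          (∀ t ∈ Ioc (0 : ℝ) θ.γ, closedBall (t : ℂ) (w1 F θ).li.r ⊆ Dset) ∧
          (∀ t ∈ Ioc (0 : ℝ) θ.γ, Fz t = (((w1 F θ).u3Objects θ.γ).EA k (Function.update g i t) U X : ℂ)))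
    (hnum : ∀ (F : T4Family) (θ : Stage13RParams F N), θ.Provisos₁₃CoPR F N → Rg F θ → θ.Admissible F N →
      0 < (w1 F θ).li.C₀ ∧ 0 < (w1 F θ).li.θ₅ ∧ (w1 F θ).li.θ₅ < 1 ∧ 0 ≤ (w1 F θ).li.C₅ ∧
        2 * (w1 F θ).li.C₅ / (1 - (w1 F θ).li.θ₅) ≤ (w1 F θ).li.C₀ ∧ 0 < (w1 F θ).li.A ∧ (w1 F θ).li.θ₅ ≤ (w1 F θ).li.μ ∧
        (w1 F θ).li.C₀ ≤ 2 * (w1 F θ).li.A ∧ 0 < (w1 F θ).li.r ∧ 0 < (w1 F θ).li.s ∧ (w1 F θ).li.s < 1) :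
    S_N22 (RRec₁₃CoPROn (readingOfRecord₁₃CoPR w1 ℓ₃ ne2 ne1) Rg) :=
  s_N22_rRec₁₃CoPROn_w1_of_s_N18_analytic _ w1 Rg (fun _ _ _ _ _ => rfl) h18 hcoh hA hnum

open Classical in
/-- **THE EDGE AT THE READING OF RECORD, REGIME HOME, STRIP CURRENCY** (§1 at `readingOfRecord₁₃CoPR w1 ℓ₃ ne2 ne1`, `hpin := rfl`). [folklore] -/
theorem s_N22_readingOfRecord₁₃CoPROn_of_s_N18_stripBound (Rg : (F : T4Family) → Stage13RParams F N → Prop)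
    (h18 : S_N18 (RRec₁₃CoPROn (readingOfRecord₁₃CoPR w1 ℓ₃ ne2 ne1) Rg))
    (hcoh : ∀ (F : T4Family) (θ : Stage13RParams F N), θ.Provisos₁₃CoPR F N → Rg F θ → θ.Admissible F N →
      (∀ (k : ℕ) (X₁ : Node00.W1.Dom (F.P k) θ.τ9.M), (((w1 F θ).pairing k).pair X₁).1 = X₁.1 + 1) ∧
      (∀ (k : ℕ) (X₁ : Node00.W1.Dom (F.P k) θ.τ9.M),
        (domSys (F.P (k + 1)) θ.τ9.M (((w1 F θ).pairing k).pair X₁).1).dj (((w1 F θ).pairing k).pair X₁).2 = (domSys (F.P k) θ.τ9.M X₁.1).dj X₁.2) ∧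
      (∀ (k : ℕ) (X : Node00.W1.Dom (F.P (k + 1)) θ.τ9.M), 1 ≤ X.1 → ∃ X₁ : Node00.W1.Dom (F.P k) θ.τ9.M, ((w1 F θ).pairing k).pair X₁ = X) ∧
      (∀ (k : ℕ) (U : ((w1 F θ).pairing (k + 1)).BgA), ∃ U₁ : ((w1 F θ).pairing k).BgB, ((w1 F θ).pairing k).embB U₁ = ((w1 F θ).pairing (k + 1)).embA U) ∧
      (∀ (k : ℕ) (g : ℕ → ℝ) (U : ((w1 F θ).pairing k).BgA) (X : Node00.W1.Dom (F.P k) θ.τ9.M), k < X.1 → ((w1 F θ).pairing k).EA ((w1 F θ).S k) g U X = 0))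
    (hnum : ∀ (F : T4Family) (θ : Stage13RParams F N), θ.Provisos₁₃CoPR F N → Rg F θ → θ.Admissible F N →
      0 < (w1 F θ).li.C₀ ∧ 0 < (w1 F θ).li.θ₅ ∧ (w1 F θ).li.θ₅ < 1 ∧ 0 ≤ (w1 F θ).li.C₅ ∧
        2 * (w1 F θ).li.C₅ / (1 - (w1 F θ).li.θ₅) ≤ (w1 F θ).li.C₀ ∧ 0 < (w1 F θ).li.A ∧ (w1 F θ).li.θ₅ ≤ (w1 F θ).li.μ ∧
        (w1 F θ).li.C₀ ≤ 2 * (w1 F θ).li.A ∧ 0 < (w1 F θ).li.r ∧ 0 < (w1 F θ).li.s ∧ (w1 F θ).li.s < 1 ∧ 1 ≤ (w1 F θ).li.μ)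
    (hstrip : ∀ (F : T4Family) (θ : Stage13RParams F N), θ.Provisos₁₃CoPR F N → Rg F θ → θ.Admissible F N → ∀ (k : ℕ),
      ∃ sp : (j : ℕ) → (domSys (F.P k) θ.τ9.M j).Dom → Set (CPair (F.P k) (MatA N)),
        (∀ (j : ℕ) (U : ((w1 F θ).pairing k).BgA) (Y : (domSys (F.P k) θ.τ9.M j).Dom), ((w1 F θ).pairing k).embA U ∈ sp j Y) ∧
        (∀ (j : ℕ) (g : ℕ → ℝ), g ∈ Window θ.γ → ∀ (i : ℕ) (Y : (domSys (F.P k) θ.τ9.M j).Dom) (ψ : CPair (F.P k) (MatA N)), ψ ∈ sp j Y →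
          ∃ (Ec : ℂ → ℂ) (O : Set ℂ), IsOpen O ∧ (∀ t ∈ Ioc (0 : ℝ) θ.γ, closedBall (t : ℂ) (w1 F θ).li.r ⊆ O) ∧ DifferentiableOn ℂ Ec O ∧
            (∀ z ∈ O, ‖Ec z‖ ≤ (w1 F θ).li.A * Real.exp (-((w1 F θ).li.κ * torusTreeLen Y.1))) ∧
            (∀ t ∈ Ioc (0 : ℝ) θ.γ, Ec t = termC ((w1 F θ).S k) j Y (Function.update g i t) ψ))) :
    S_N22 (RRec₁₃CoPROn (readingOfRecord₁₃CoPR w1 ℓ₃ ne2 ne1) Rg) :=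
  s_N22_rRec₁₃CoPROn_w1_of_s_N18_stripBound _ w1 Rg (fun _ _ _ _ _ => rfl) h18 hcoh hnum hstrip

end ReadingOfRecord

end YMDAG.N22

end
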